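/-
Copyright: the b2b-balaban T⁴-continuum CRUX team, row NE7b leaf lineage `t4-ne7b-formalise-leaf-03` (gen 150). Project licence.
-/
import Summits.QuantumFields.BalabanUV.T4Continuum.Spine.NE7b.TransportedFormCoercivity
import Mathlib.Analysis.Normed.Operator.Bilinear
import Mathlib.Analysis.Calculus.FDeriv.Comp

/-!
# THE HARD-STEP TOWER IS ONE STEP AT EVERY LEVEL: along a tower of blockings `D k : X k → X (k+1)` with step sections `T k` that are
# critical for the step-by-step transported forms `Q_k = Q[T⁽ᵏ⁾·, T⁽ᵏ⁾·]`, the composite section `T⁽ᵏ⁾ = T 0 ∘ ⋯ ∘ T (k−1)` is, for EVERY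
# `k`, the critical section of the composite blocking `D⁽ᵏ⁾ = D (k−1) ∘ ⋯ ∘ D 0` for the ORIGINAL form `Q`, `Q_k` is `Q` transported ONCE
# along `T⁽ᵏ⁾`, the level-`k` kernel coercivity comes from ONE `(k+1)`-scale letter of `Q`, and the composite sections are unique; the
# same by induction for the NONLINEAR tower of constrained-critical branches (row NE7b, node U5c; the `n`-step packaging of this
# lineage's `…HardStepSemigroup` (HSSG, two steps) — by induction over `ℕ` on a family of spaces, no `def`: the composites are DATA with
# their recursion letters; [folklore])

Cell `pub-balaban`, sub-cell `t4`, spine estimate NE7b (`T4WeightBudget.RelWeightBound`; the cell's OWN estimate — NOT PRINTED in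
[Bałaban 1983–89], NOT PROVED).  Crux-route work under `Spine/NE7b/` by leaf-03 (CRUX team (2), FREEZE (0) crux-prover clause) in the
hard-step cell.  NOTHING of Bałaban's is named, asserted, valued or discharged; no `T4Continuum/Support` leaf typed; no `def`; zero
`sorry`.  Imports: this lineage's BUILT `…TransportedFormCoercivity` (TFC: `kerCoercive_bilinearComp_div` BY NAME) + Mathlib; this
lineage's `…QuadraticFibreMinimiser` (QFM) §1 is met BY SHAPE (its `le_of_orthogonal_ker` ∕ `eq_of_orthogonal_ker` arguments, three
and eight lines of algebra, are re-run in the normed-FAMILY context `X : ℕ → Type*`, where an inner-product instance on `X 0` alone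
would clash with the family's normed-space instance — not restated in QFM's context).  HSSG (`…HardStepSemigroup`, p385300: the two-step law) is met BY SHAPE — its
six-line split argument is INLINED in the induction steps (a `have`, not a declaration), so that this file does not wait for HSSG's olean.

WHY.  HSSG proves «two hard steps are one» and leaves the `n`-step packaging to iteration.  A tower consumer (leaf-06's HSUT ∕ HSTT box,
the KKT tower of HKIS, or an (A3) instance on print's `k`-fold averagings) wants the statement AT EVERY LEVEL `k` with the composite
objects named: the `k`-th action's Hessian transport `Q_k`, the composite blocking `D⁽ᵏ⁾` from the fine lattice, the composite section
`T⁽ᵏ⁾`.  Without definitions this is done by taking the composites as DATA (`Dc k : X 0 → X k`, `Tc k : X k → X 0`) together with their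
recursion letters `Dc 0 = 1`, `Dc (k+1) = D k ∘ Dc k`, `Tc 0 = 1`, `Tc (k+1) = Tc k ∘ T k`, and proving everything by induction on `k`.
The pay-off is the pricing desk's F689 (5) in theorem form: the level-`k` letters are ONE-STEP letters of `(Q, D⁽ᵏ⁾, T⁽ᵏ⁾)` — the
coercivity of `Q_k` on `ker (D k)` from the `(k+1)`-scale coercivity of `Q` on `ker D⁽ᵏ⁺¹⁾` and `‖D⁽ᵏ⁾‖` (TFC once per level, never
iterated), the size of `Q_k` through a test section of `D⁽ᵏ⁾` (QFM once; THEC's END), with NO compounding across levels.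

WHAT IS PROVED ([folklore]; `X : ℕ → Type*` real normed spaces, `Q : X 0 →L X 0 →L ℝ` (no
symmetry unless said), steps `D k : X k →L X (k+1)`, `T k : X (k+1) →L X k`, composites `Dc k : X 0 →L X k`, `Tc k : X k →L X 0` with the
four recursion letters; the step-`k` CRITICALITY letter is written out on the composite objects:
`∀ g v, D k v = 0 → Q (Tc k (T k g)) (Tc k v) = 0`, i.e. `Q_k (T k g)|_{ker (D k)} = 0` for `Q_k = Q.bilinearComp (Tc k) (Tc k)`):
* §1 THE LINEAR TOWER: `tower_section` (`Dc k (Tc k g) = g` for all `k`), **`tower_orthogonal`** (`Q (Tc k g)|_{ker (Dc k)} = 0` for all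
  `k` — the composite section is critical for the composite blocking), `tower_form` (`(Q_k).bilinearComp (T k) (T k) = Q_{k+1}` — the
  step-by-step transported form IS `Q` transported once along `Tc (k+1)`), `tower_orthogonal'` (the second letter, for non-symmetric `Q`,
  from the steps' second letters).
* §2 ONE-SHOT LETTERS AT LEVEL `k`: **`tower_kerCoercive`** (`Q` `m`-coercive on `ker (Dc (k+1))`, `‖Dc k x‖ ≤ d‖x‖`, `0 < d` ⟹
  `∀ g, D k g = 0 → (m∕d²)‖g‖² ≤ Q_k g g` — TFC ONCE at `(Dc k, Tc k, D k)`), **`tower_quad_le_of_testSection`** (`Q` symmetric `≥ 0` on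
  `ker (Dc k)`, ANY section `S` of `Dc k` with `Q (S g) (S g) ≤ C‖g‖²` ⟹ `Q_k g g ≤ C‖g‖²` — Pythagoras on the composite fibre ONCE,
  QFM §1's argument), **`tower_unique`** (`Q` `m`-coercive on `ker (Dc k)`: any critical section of `Dc k` equals `Tc k` — QFM
  `propagator_unique`'s argument).
* §3 THE NONLINEAR TOWER: branches `σ k : X (k+1) → X k` on charts `U k ⊆ X k` with `σ k (U (k+1)) ⊆ U k`, composites `σc k : X k → X 0`
  with `σc 0 = id`, `σc (k+1) = σc k ∘ σ k` (letters); step letters: `σ k` differentiable on `U (k+1)` with `D k (σ k′ h) = h`, and the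
  step-`k` CRITICALITY of the `k`-th action `V ∘ σc k` — `∀ g ∈ U (k+1), D(V ∘ σc k)(σ k g)|_{ker (D k)} = 0` (HSIC's (o)); `V`
  differentiable on `σc k (U k)`.  **`tower_branch_letters`**: for every `k`, on `U k`: `σc k` differentiable, `Dc k ∘ (σc k)′(g) = 1`,
  and **`DV(σc k g)|_{ker (Dc k)} = 0`** — the `k`-th action is `V` at a constrained-critical point of the COMPOSITE fibre, at every level.
* §4 toy: the constant tower on `ℝ` (`D k = T k = 1`, `Q = mul`).

NOT HERE (honest): the letters BY VALUE for Bałaban's averagings ((A3) ∕ (A1c), NC-NE7b-α UNRULED); existence of the step sections ∕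
branches (QFM ∕ HSCR per level, or ONCE at the composite by HSSG §2); rescalings between levels (leaf-06's `…HardStepRescalingLetters`
composes with the composites as a further `comp`); the KKT tower (HSSP `kkt_comp` iterates the same way); anything of Bałaban's.
BY-NAME EFFECT ON THE WALL: NONE.  NE7b NOT PRINTED ∕ NOT PROVED; spine PROVED 0∕9; rung (B)+1 on a FINITE torus — NOT infinite volume,
NOT the mass gap, NOT Clay.  HONEST DEPENDENCY: continuum YM on T⁴ ⇐ BetaPertH ∧ nine spine estimates (0∕9 proved); BetaPertH ⇐ (D1) ∧
(D4) ∧ CAP+tail; G-an2-4 gates asym, D1 and NE2∕3∕4.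
-/

set_option autoImplicit false

namespace Summit.QuantumFields.BalabanUV.T4Continuum.NE7b.HardStepSemigroupTower

open Summit.QuantumFields.BalabanUV.T4Continuum.NE7b

/-! ## §1. The linear tower: composite sections are critical for composite blockings, at every level -/

section Linear

variable {X : ℕ → Type*} [∀ k, NormedAddCommGroup (X k)] [∀ k, NormedSpace ℝ (X k)]
  (Q : X 0 →L[ℝ] X 0 →L[ℝ] ℝ) {D : ∀ k, X k →L[ℝ] X (k + 1)} {T : ∀ k, X (k + 1) →L[ℝ] X k}
  {Dc : ∀ k, X 0 →L[ℝ] X k} {Tc : ∀ k, X k →L[ℝ] X 0}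

/-- The composite section is a section of the composite blocking at every level: `Dc k (Tc k g) = g`. [folklore] -/
theorem tower_section (hDc0 : Dc 0 = ContinuousLinearMap.id ℝ (X 0)) (hDcs : ∀ k, Dc (k + 1) = (D k).comp (Dc k))
    (hTc0 : Tc 0 = ContinuousLinearMap.id ℝ (X 0)) (hTcs : ∀ k, Tc (k + 1) = (Tc k).comp (T k))
    (hT : ∀ k g, D k (T k g) = g) : ∀ k g, Dc k (Tc k g) = g := by
  intro k
  induction k with
  | zero => intro g; rw [hDc0, hTc0]; rfl
  | succ k ih => intro g; rw [hDcs k, hTcs k]; simp only [ContinuousLinearMap.coe_comp, Function.comp_apply, ih, hT]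

/-- **THE COMPOSITE SECTION IS CRITICAL FOR THE COMPOSITE BLOCKING, AT EVERY LEVEL (first letter).**  From the step criticality
letters `Q (Tc k (T k g)) (Tc k v) = 0` for `D k v = 0` (step `k`'s section is `Q_k`-orthogonal to `ker (D k)`): for all `k`,
`Q (Tc k g) x = 0` whenever `Dc k x = 0` — by induction, splitting `x = (x − Tc k (Dc k x)) + Tc k (Dc k x)` (HSSG §1's argument). [folklore] -/
theorem tower_orthogonal (hDc0 : Dc 0 = ContinuousLinearMap.id ℝ (X 0)) (hDcs : ∀ k, Dc (k + 1) = (D k).comp (Dc k))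
    (hTc0 : Tc 0 = ContinuousLinearMap.id ℝ (X 0)) (hTcs : ∀ k, Tc (k + 1) = (Tc k).comp (T k))
    (hT : ∀ k g, D k (T k g) = g) (horth : ∀ k g v, D k v = 0 → Q (Tc k (T k g)) (Tc k v) = 0) :
    ∀ k g x, Dc k x = 0 → Q (Tc k g) x = 0 := by
  intro k
  induction k with
  | zero =>
      intro g x hx
      rw [hDc0] at hx
      have : x = 0 := by simpa using hx
      rw [this, map_zero]
  | succ k ih =>
      intro g x hx
      have hsec := tower_section hDc0 hDcs hTc0 hTcs hT k
      rw [hDcs k, ContinuousLinearMap.coe_comp, Function.comp_apply] at hx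
      have hκ : Dc k (x - Tc k (Dc k x)) = 0 := by rw [map_sub, hsec, sub_self]
      rw [hTcs k, ContinuousLinearMap.coe_comp, Function.comp_apply]
      have e : Q (Tc k (T k g)) x = Q (Tc k (T k g)) (x - Tc k (Dc k x)) + Q (Tc k (T k g)) (Tc k (Dc k x)) := by
        rw [map_sub, sub_add_cancel]
      rw [e, ih (T k g) _ hκ, zero_add]
      exact horth k g (Dc k x) hx

/-- The second orthogonality letter at every level (non-symmetric `Q`), from the steps' second letters
`Q (Tc k v) (Tc k (T k g)) = 0` for `D k v = 0`. [folklore] -/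
theorem tower_orthogonal' (hDc0 : Dc 0 = ContinuousLinearMap.id ℝ (X 0)) (hDcs : ∀ k, Dc (k + 1) = (D k).comp (Dc k))
    (hTc0 : Tc 0 = ContinuousLinearMap.id ℝ (X 0)) (hTcs : ∀ k, Tc (k + 1) = (Tc k).comp (T k))
    (hT : ∀ k g, D k (T k g) = g) (horth' : ∀ k g v, D k v = 0 → Q (Tc k v) (Tc k (T k g)) = 0) :
    ∀ k g x, Dc k x = 0 → Q x (Tc k g) = 0 := by
  intro k
  induction k with
  | zero =>
      intro g x hx
      rw [hDc0] at hx
      have : x = 0 := by simpa using hx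
      rw [this, map_zero, zero_apply]
  | succ k ih =>
      intro g x hx
      have hsec := tower_section hDc0 hDcs hTc0 hTcs hT k
      rw [hDcs k, ContinuousLinearMap.coe_comp, Function.comp_apply] at hx
      have hκ : Dc k (x - Tc k (Dc k x)) = 0 := by rw [map_sub, hsec, sub_self]
      rw [hTcs k, ContinuousLinearMap.coe_comp, Function.comp_apply]
      have e : Q x (Tc k (T k g)) = Q (x - Tc k (Dc k x)) (Tc k (T k g)) + Q (Tc k (Dc k x)) (Tc k (T k g)) := by
        rw [map_sub, sub_apply, sub_add_cancel]
      rw [e, ih (T k g) _ hκ, zero_add]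
      exact horth' k g (Dc k x) hx

/-- The step-by-step transported form IS `Q` transported once: `(Q.bilinearComp (Tc k) (Tc k)).bilinearComp (T k) (T k) =
Q.bilinearComp (Tc (k+1)) (Tc (k+1))`. [folklore] -/
theorem tower_form (hTcs : ∀ k, Tc (k + 1) = (Tc k).comp (T k)) (k : ℕ) :
    (Q.bilinearComp (Tc k) (Tc k)).bilinearComp (T k) (T k) = Q.bilinearComp (Tc (k + 1)) (Tc (k + 1)) := by
  ext g g'
  simp only [ContinuousLinearMap.bilinearComp_apply, hTcs k, ContinuousLinearMap.coe_comp, Function.comp_apply]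

end Linear

/-! ## §2. One-shot letters at level `k` (TFC ∕ QFM BY NAME, once per level) -/

section OneShot

variable {X : ℕ → Type*} [∀ k, NormedAddCommGroup (X k)] [∀ k, NormedSpace ℝ (X k)]
  (Q : X 0 →L[ℝ] X 0 →L[ℝ] ℝ) {D : ∀ k, X k →L[ℝ] X (k + 1)} {T : ∀ k, X (k + 1) →L[ℝ] X k}
  {Dc : ∀ k, X 0 →L[ℝ] X k} {Tc : ∀ k, X k →L[ℝ] X 0}

/-- **LEVEL-`k` KERNEL COERCIVITY IN ONE SHOT**: `Q` `m`-coercive on `ker (Dc (k+1))` (ONE `(k+1)`-scale letter of `Q` itself) and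
`‖Dc k x‖ ≤ d‖x‖` (`0 < d`) ⟹ the level-`k` form `Q_k = Q.bilinearComp (Tc k) (Tc k)` is `(m∕d²)`-coercive on `ker (D k)` — TFC
`kerCoercive_bilinearComp_div` ONCE at `(D, S, D⁺) := (Dc k, Tc k, D k)`; no letter of an intermediate level is used. [folklore] -/
theorem tower_kerCoercive (hDc0 : Dc 0 = ContinuousLinearMap.id ℝ (X 0)) (hDcs : ∀ k, Dc (k + 1) = (D k).comp (Dc k))
    (hTc0 : Tc 0 = ContinuousLinearMap.id ℝ (X 0)) (hTcs : ∀ k, Tc (k + 1) = (Tc k).comp (T k))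
    (hT : ∀ k g, D k (T k g) = g) (k : ℕ) {m : ℝ} (hm : 0 ≤ m) (hco : ∀ x, Dc (k + 1) x = 0 → m * ‖x‖ ^ 2 ≤ Q x x)
    {d : ℝ} (hd0 : 0 < d) (hd : ∀ x, ‖Dc k x‖ ≤ d * ‖x‖) :
    ∀ g, D k g = 0 → m / d ^ 2 * ‖g‖ ^ 2 ≤ (Q.bilinearComp (Tc k) (Tc k)) g g :=
  TransportedFormCoercivity.kerCoercive_bilinearComp_div (D := Dc k) (S := Tc k) (tower_section hDc0 hDcs hTc0 hTcs hT k) (D k)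
    hm (fun x hx => hco x (by rw [hDcs k, ContinuousLinearMap.coe_comp, Function.comp_apply, hx])) hd0 hd

end OneShot

section OneShotAlgebra

variable {X : ℕ → Type*} [∀ k, NormedAddCommGroup (X k)] [∀ k, NormedSpace ℝ (X k)]
  (Q : X 0 →L[ℝ] X 0 →L[ℝ] ℝ) {D : ∀ k, X k →L[ℝ] X (k + 1)} {T : ∀ k, X (k + 1) →L[ℝ] X k}
  {Dc : ∀ k, X 0 →L[ℝ] X k} {Tc : ∀ k, X k →L[ℝ] X 0}

/-- **LEVEL-`k` SIZE THROUGH ONE TEST SECTION OF THE COMPOSITE**: `Q` symmetric and `≥ 0` on `ker (Dc k)`, the tower letters, and ANY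
section `S` of `Dc k` with `Q (S g) (S g) ≤ C‖g‖²` ⟹ `Q_k g g ≤ C‖g‖²` — Pythagoras along the composite fibre ONCE (QFM
`le_of_orthogonal_ker`'s three-line argument, written in the normed-family context: `Q x x = Q h h + 2 Q h (x − h) + Q (x − h) (x − h)`). [folklore] -/
theorem tower_quad_le_of_testSection (hDc0 : Dc 0 = ContinuousLinearMap.id ℝ (X 0))
    (hDcs : ∀ k, Dc (k + 1) = (D k).comp (Dc k)) (hTc0 : Tc 0 = ContinuousLinearMap.id ℝ (X 0))
    (hTcs : ∀ k, Tc (k + 1) = (Tc k).comp (T k)) (hT : ∀ k g, D k (T k g) = g)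
    (horth : ∀ k g v, D k v = 0 → Q (Tc k (T k g)) (Tc k v) = 0) (hsymm : ∀ x y, Q x y = Q y x) (k : ℕ)
    (hpos : ∀ x, Dc k x = 0 → 0 ≤ Q x x) (S : X k →L[ℝ] X 0) (hS : ∀ g, Dc k (S g) = g) {C : ℝ}
    (hC : ∀ g, Q (S g) (S g) ≤ C * ‖g‖ ^ 2) (g : X k) : (Q.bilinearComp (Tc k) (Tc k)) g g ≤ C * ‖g‖ ^ 2 := by
  rw [ContinuousLinearMap.bilinearComp_apply]
  have hκ : Dc k (S g - Tc k g) = 0 := by rw [map_sub, hS, tower_section hDc0 hDcs hTc0 hTcs hT k, sub_self]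
  have ho : Q (Tc k g) (S g - Tc k g) = 0 := tower_orthogonal Q hDc0 hDcs hTc0 hTcs hT horth k g _ hκ
  have e : Q (S g) (S g) = Q (Tc k g) (Tc k g) + 2 * Q (Tc k g) (S g - Tc k g) + Q (S g - Tc k g) (S g - Tc k g) := by
    simp only [map_sub, sub_apply]
    rw [hsymm (S g) (Tc k g)]
    ring
  have h := hpos _ hκ
  rw [ho] at e
  linarith [hC g]

/-- **UNIQUENESS AT LEVEL `k`**: `Q` `m`-coercive on `ker (Dc k)` ⟹ ANY section `H` of `Dc k` whose values are `Q`-orthogonal to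
`ker (Dc k)` equals the composite section `Tc k` (QFM `propagator_unique`'s argument in the normed-family context: test the coercivity
at `H g − Tc k g ∈ ker (Dc k)`); so the step-by-step tower and any one-shot construction at the composite data (QFM `exists_propagator`
∕ HSCR at `Dc k`) are the same object. [folklore] -/
theorem tower_unique (hDc0 : Dc 0 = ContinuousLinearMap.id ℝ (X 0)) (hDcs : ∀ k, Dc (k + 1) = (D k).comp (Dc k))
    (hTc0 : Tc 0 = ContinuousLinearMap.id ℝ (X 0)) (hTcs : ∀ k, Tc (k + 1) = (Tc k).comp (T k))
    (hT : ∀ k g, D k (T k g) = g) (horth : ∀ k g v, D k v = 0 → Q (Tc k (T k g)) (Tc k v) = 0) (k : ℕ) {m : ℝ}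
    (hm : 0 < m) (hco : ∀ x, Dc k x = 0 → m * ‖x‖ ^ 2 ≤ Q x x) {H : X k →L[ℝ] X 0} (hH : ∀ g, Dc k (H g) = g)
    (hHo : ∀ g x, Dc k x = 0 → Q (H g) x = 0) : H = Tc k := by
  ext g
  have hκ : Dc k (H g - Tc k g) = 0 := by rw [map_sub, hH, tower_section hDc0 hDcs hTc0 hTcs hT k, sub_self]
  have h1 := hco _ hκ
  have h2 : Q (H g - Tc k g) (H g - Tc k g) = 0 := by
    rw [map_sub Q (H g) (Tc k g), sub_apply, hHo g _ hκ, tower_orthogonal Q hDc0 hDcs hTc0 hTcs hT horth k g _ hκ, sub_self]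
  rw [h2] at h1
  have h3 : ‖H g - Tc k g‖ ^ 2 ≤ 0 := le_of_mul_le_mul_left (by linarith : m * ‖H g - Tc k g‖ ^ 2 ≤ m * 0) hm
  have h4 : ‖H g - Tc k g‖ ^ 2 = 0 := le_antisymm h3 (sq_nonneg _)
  exact sub_eq_zero.mp (norm_eq_zero.mp ((pow_eq_zero_iff two_ne_zero).mp h4))

end OneShotAlgebra

/-! ## §3. The nonlinear tower: the `k`-th action is `V` at a constrained-critical point of the composite fibre -/

section Nonlinear

variable {X : ℕ → Type*} [∀ k, NormedAddCommGroup (X k)] [∀ k, NormedSpace ℝ (X k)]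
  {V : X 0 → ℝ} {D : ∀ k, X k →L[ℝ] X (k + 1)} {Dc : ∀ k, X 0 →L[ℝ] X k}
  {σ : ∀ k, X (k + 1) → X k} {σc : ∀ k, X k → X 0} {U : ∀ k, Set (X k)}

/-- **THE NONLINEAR TOWER's LETTERS AT EVERY LEVEL.**  Composite blockings `Dc` (recursion letters), step branches `σ k` on charts
`U (k+1) → U k`, composite branches `σc` with `σc 0 = id`, `σc (k+1) = σc k ∘ σ k`; step letters: `σ k` differentiable on `U (k+1)`
with the section letter `D k ((σ k)′ h) = h`; `V` differentiable at `σc k g` for `g ∈ U k`; and step `k`'s CONSTRAINED CRITICALITY of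
the `k`-th action, `D(V ∘ σc k)(σ k g) v = 0` for `D k v = 0`, `g ∈ U (k+1)` (HSIC (o)).  THEN for every `k` and `g ∈ U k`: `σc k` is
differentiable at `g`, `Dc k ((σc k)′(g) x) = x`, and `DV(σc k g) x = 0` for every `x ∈ ker (Dc k)` — by induction, the step being
HSSG §4's split + chain rule (inlined). [folklore] -/
theorem tower_branch_letters (hDc0 : Dc 0 = ContinuousLinearMap.id ℝ (X 0)) (hDcs : ∀ k, Dc (k + 1) = (D k).comp (Dc k))
    (hσc0 : σc 0 = id) (hσcs : ∀ k, σc (k + 1) = σc k ∘ σ k) (hmaps : ∀ k, Set.MapsTo (σ k) (U (k + 1)) (U k))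
    (hσd : ∀ k, ∀ g ∈ U (k + 1), DifferentiableAt ℝ (σ k) g)
    (hsec : ∀ k, ∀ g ∈ U (k + 1), ∀ h, D k (fderiv ℝ (σ k) g h) = h)
    (hVd : ∀ k, ∀ g ∈ U k, DifferentiableAt ℝ V (σc k g))
    (hcrit : ∀ k, ∀ g ∈ U (k + 1), ∀ v, D k v = 0 → fderiv ℝ (V ∘ σc k) (σ k g) v = 0) :
    ∀ k, ∀ g ∈ U k, DifferentiableAt ℝ (σc k) g ∧ (∀ x, Dc k (fderiv ℝ (σc k) g x) = x) ∧
      ∀ x, Dc k x = 0 → fderiv ℝ V (σc k g) x = 0 := by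
  intro k
  induction k with
  | zero =>
      intro g _
      rw [hσc0, hDc0]
      refine ⟨differentiableAt_id, fun x => by simp [fderiv_id], fun x hx => ?_⟩
      have : x = 0 := by simpa using hx
      rw [this, map_zero]
  | succ k ih =>
      intro g hg
      have hg' : σ k g ∈ U k := hmaps k hg
      obtain ⟨hdk, hseck, hcritk⟩ := ih (σ k g) hg'
      -- differentiability and the derivative of the composite branch
      have hd1 : DifferentiableAt ℝ (σc (k + 1)) g := by
        rw [hσcs k]; exact hdk.comp g (hσd k g hg)
      have hfd : fderiv ℝ (σc (k + 1)) g = (fderiv ℝ (σc k) (σ k g)).comp (fderiv ℝ (σ k) g) := by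
        rw [hσcs k]; exact fderiv_comp g hdk (hσd k g hg)
      refine ⟨hd1, fun x => ?_, fun x hx => ?_⟩
      · rw [hfd, hDcs k, ContinuousLinearMap.coe_comp, Function.comp_apply, ContinuousLinearMap.coe_comp,
          Function.comp_apply, hseck, hsec k g hg]
      · -- criticality: split `x = (x − (σc k)′ (Dc k x)) + (σc k)′ (Dc k x)` (HSSG §4, inlined)
        rw [hDcs k, ContinuousLinearMap.coe_comp, Function.comp_apply] at hx
        have hpt : σc (k + 1) g = σc k (σ k g) := by rw [hσcs k]; rfl
        rw [hpt]
        have hchain : fderiv ℝ (V ∘ σc k) (σ k g) = (fderiv ℝ V (σc k (σ k g))).comp (fderiv ℝ (σc k) (σ k g)) :=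
          fderiv_comp (σ k g) (hVd k _ hg') hdk
        have hκ : Dc k (x - fderiv ℝ (σc k) (σ k g) (Dc k x)) = 0 := by rw [map_sub, hseck, sub_self]
        have e : fderiv ℝ V (σc k (σ k g)) x = fderiv ℝ V (σc k (σ k g)) (x - fderiv ℝ (σc k) (σ k g) (Dc k x)) +
            fderiv ℝ V (σc k (σ k g)) (fderiv ℝ (σc k) (σ k g) (Dc k x)) := by
          rw [map_sub, sub_add_cancel]
        rw [e, hcritk _ hκ, zero_add]
        have h2 := hcrit k g hg (Dc k x) hx
        rw [hchain] at h2
        simpa using h2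

end Nonlinear

/-! ## §4. Toy: the constant tower on `ℝ` -/

/-- Toy (non-vacuity of §1's letter list): `X k = ℝ`, `D k = T k = Dc k = Tc k = 1`, `Q = mul`: the composite section is a
section at every level and `Q (Tc k g)` kills `ker (Dc k) = 0`. -/
example (k : ℕ) (g x : ℝ) (hx : (fun _ : ℕ => ContinuousLinearMap.id ℝ ℝ) k x = 0) :
    ContinuousLinearMap.mul ℝ ℝ ((fun _ : ℕ => ContinuousLinearMap.id ℝ ℝ) k g) x = 0 :=
  tower_orthogonal (X := fun _ => ℝ) (ContinuousLinearMap.mul ℝ ℝ) (D := fun _ => ContinuousLinearMap.id ℝ ℝ)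
    (T := fun _ => ContinuousLinearMap.id ℝ ℝ) (Dc := fun _ => ContinuousLinearMap.id ℝ ℝ)
    (Tc := fun _ => ContinuousLinearMap.id ℝ ℝ) rfl (fun _ => rfl) rfl (fun _ => rfl) (fun _ _ => rfl)
    (fun _ g v hv => by simp only [ContinuousLinearMap.coe_id', id_eq] at hv; subst hv; simp) k g x hx

/-! ## §5. (v1.1, appended) The nonlinear tower IS the one-shot composite chart where both exist — the chart radius is one-shot -/

section OneShotChart

variable {X : ℕ → Type*} [∀ k, NormedAddCommGroup (X k)] [∀ k, NormedSpace ℝ (X k)]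
  {V : X 0 → ℝ} {Dc : ∀ k, X 0 →L[ℝ] X k} {σc : ∀ k, X k → X 0} {U : ∀ k, Set (X k)}

/-- **THE ITERATED BRANCH IS THE ONE-SHOT COMPOSITE BRANCH (uniqueness).**  At level `k`, let `σk` be ANY branch of the COMPOSITE
blocking `Dc k` carrying HSCR `exists_criticalBranch_chart_ker`'s UNIQUENESS clause on the fine ball (`∀ δ ∈ closedBall δ₀ r`,
`DV(δ)|_{ker (Dc k)} = 0 → σk (Dc k δ) = δ` — every constrained-critical point of the fine ball lies on the branch), and let the
iterated tower branch `σc k` have §3's letters on `U k` (fibre `Dc k (σc k g) = g` and constrained criticality `DV(σc k g)|_{ker (Dc k)} = 0`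
— `tower_branch_letters`) and stay in the fine ball.  Then `σk g = σc k g` on `U k`: the tower built step by step and the chart built ONCE
at the composite data are the same map, so the level-`k` chart RADIUS is HSCR's one-shot `(N_k⁻¹ − c)·r` for the composite — ONE
Neumann factor, not the product of the steps' `(N_j⁻¹ − c_j)∕|t|` (the pricing desk's F660 ∕ F698 (iv) radius contraction is a
property of ITERATED charts, not of the branch). [folklore] -/
theorem tower_branch_eq_oneShot (k : ℕ) {σk : X k → X 0} {δ₀ : X 0} {r : ℝ}
    (huniq : ∀ δ ∈ Metric.closedBall δ₀ r, (∀ x, Dc k x = 0 → fderiv ℝ V δ x = 0) → σk (Dc k δ) = δ)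
    (hfib : ∀ g ∈ U k, Dc k (σc k g) = g) (hcrit : ∀ g ∈ U k, ∀ x, Dc k x = 0 → fderiv ℝ V (σc k g) x = 0)
    (hball : ∀ g ∈ U k, σc k g ∈ Metric.closedBall δ₀ r) : ∀ g ∈ U k, σk g = σc k g := by
  intro g hg
  have h := huniq (σc k g) (hball g hg) (hcrit g hg)
  rwa [hfib g hg] at h

/-- The same read directly on §3's step letters: with `tower_branch_letters`' hypotheses (composite blockings, step branches on charts
`U (k+1) → U k`, step differentiability ∕ section ∕ criticality letters), the fibre letters of the steps (`D k (σ k g) = g` on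
`U (k+1)`), a one-shot composite branch `σk` with HSCR's uniqueness clause, and the tower staying in the fine ball ⟹ `σk = σc k` on
`U k`. [folklore] -/
theorem tower_branch_eq_oneShot_of_letters {D : ∀ k, X k →L[ℝ] X (k + 1)} {σ : ∀ k, X (k + 1) → X k}
    (hDc0 : Dc 0 = ContinuousLinearMap.id ℝ (X 0)) (hDcs : ∀ k, Dc (k + 1) = (D k).comp (Dc k))
    (hσc0 : σc 0 = id) (hσcs : ∀ k, σc (k + 1) = σc k ∘ σ k) (hmaps : ∀ k, Set.MapsTo (σ k) (U (k + 1)) (U k))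
    (hσfib : ∀ k, ∀ g ∈ U (k + 1), D k (σ k g) = g)
    (hσd : ∀ k, ∀ g ∈ U (k + 1), DifferentiableAt ℝ (σ k) g)
    (hsec : ∀ k, ∀ g ∈ U (k + 1), ∀ h, D k (fderiv ℝ (σ k) g h) = h)
    (hVd : ∀ k, ∀ g ∈ U k, DifferentiableAt ℝ V (σc k g))
    (hcrit : ∀ k, ∀ g ∈ U (k + 1), ∀ v, D k v = 0 → fderiv ℝ (V ∘ σc k) (σ k g) v = 0)
    (k : ℕ) {σk : X k → X 0} {δ₀ : X 0} {r : ℝ}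
    (huniq : ∀ δ ∈ Metric.closedBall δ₀ r, (∀ x, Dc k x = 0 → fderiv ℝ V δ x = 0) → σk (Dc k δ) = δ)
    (hball : ∀ g ∈ U k, σc k g ∈ Metric.closedBall δ₀ r) : ∀ g ∈ U k, σk g = σc k g := by
  have hfib : ∀ k, ∀ g ∈ U k, Dc k (σc k g) = g := by
    intro k
    induction k with
    | zero => intro g _; rw [hDc0, hσc0]; rfl
    | succ k ih =>
        intro g hg
        rw [hDcs k, hσcs k, ContinuousLinearMap.coe_comp, Function.comp_apply, Function.comp_apply, ih _ (hmaps k hg),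
          hσfib k g hg]
  exact tower_branch_eq_oneShot k huniq (hfib k)
    (fun g hg => (tower_branch_letters hDc0 hDcs hσc0 hσcs hmaps hσd hsec hVd hcrit k g hg).2.2) hball

end OneShotChart

end Summit.QuantumFields.BalabanUV.T4Continuum.NE7b.HardStepSemigroupTower
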